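import Summits.HubbardSuperconductivity.HubbardSuperconductivity.Theorems.BalabanIRBirBdGPhaseCoercivityLyapunovCore
import Summits.HubbardSuperconductivity.HubbardSuperconductivity.Theorems.BalabanIRBirGappedPhaseReductionRChiralityWallSymbols

/-!
# Route BalabanIR — crux 4R `BirGappedPhaseReductionR` (item `stmt-HubbardSuperconductivity-14846`),
# line `chirality-sheet-peierls`, static input (W): chirality-wall coercivity of the `d+id`
# Bogoliubov–de Gennes energy — the Lyapunov (BCS-duality) commutator bound

The card `chirality-sheet-peierls` (Cruxes/BirGappedPhaseReductionR/Ideas) integrates the local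
`d+id / d−id` Ising field `σ` out of the Hubbard phase marginal by a sheet-Peierls step whose only
analytic input is the STATIC inequality (`BdGChiralityWallCoercivity`, Sketch §B of ideator 2; stub
`stub_chiralityWallCoercivity` of the line's skeleton)
  `c_w · #frustrated diagonal bonds(σ) ≤ Σ_i |λ_i(Hb(+))| - Σ_i |λ_i(Hb(σ))|`,
uniformly in `L` and for ALL chirality textures `σ : (ℤ/L)² → Bool`, where `Hb(σ) = [[h, D_σ], [D_σᴴ, -h]]`
is crux 3's BdG matrix at zero phase texture with the `d_xy` bond amplitude multiplied by the bond
average `(s_x + s_y)/2`, `s = ±1`.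

THEOREM (`chir_core`, this file). With the symbols `ξ_k`, `Δ_k = A_k + B_k`
(`A_k = 2Δ₁(cos p₀ - cos p₁)` real, `B_k = -4iΔ₂ sin p₀ sin p₁` imaginary), `E_k = √(ξ_k² + |Δ_k|²) ≥ m > 0`
and the position-space `d_xy` anomalous amplitude `F_B = N⁻¹ Wᴴ diag(B/E) W` of the reference:
for every `s : (ℤ/L)² → {±1}`,
  `(m/4) Σ_{x,y} |F_B(x,y)|² |s_y - s_x|² ≤ Σ_i |λ_i(Hb(+))| - Σ_i |λ_i(Hb(σ))|`.
PROOF. Crux 3's abstract deficit bound `BirBdG.lyap_deficit` (Legendre duality of the BCS functional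
with the Lyapunov pair interaction, Bach's inequality) with the SAME reference `C = circulant(d+id stencil)`
and the chirality pairing block `D_σ = circulant(dv₁) + ½(diag s · circulant(dv₂) + circulant(dv₂) · diag s)`:
`S(+) - S(σ) ≥ Σ_k |Δ_k|²/E_k - 2 Σ_{kk'} |D̂_σ(k,k')|²/(E_k + E_{k'})`. In the plane-wave basis
`D̂_σ(k,k') = δ_{kk'} A_k + ½ Ŝ_{kk'} (B_k + B_{k'})` (`hat_pairing_apply`), and the `A`–`B` cross terms
VANISH (`A_k` real, `B_k` imaginary, `Ŝ_{kk} = N⁻¹ Σ_x s_x` real), so the right-hand side is the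
Bergström sum `½ Σ_{kk'} |Ŝ_{kk'}|² [|B_k|²/E_k + |B_{k'}|²/E_{k'} - |B_k + B_{k'}|²/(E_k + E_{k'})]
≥ (m/4) Σ_{kk'} |Ŝ_{kk'}|² |B_k/E_k - B_{k'}/E_{k'}|² = (m/4) ‖[F_B, diag s]‖²_HS`
exactly as in `BirBdG.lyap_core` (unit row/column sums of the unitary `Ŝ = (diag s)^`).
The companion files `…ChiralityWallBond` (diagonal-bond amplitude of `F_B`) and `…ChiralityWall`
(uniform gap, assembly) turn this into the card's inequality with `c_w = m Δ₂²/E_max²`.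

References: V. Bach, E. H. Lieb, J. P. Solovej, J. Stat. Phys. 76 (1994) 3; A. Deuchert,
A. Geisinger, C. Hainzl, M. Loss, Ann. Henri Poincaré 19 (2018) 1507, Lemma 4.1; M. Sigrist, K. Ueda,
Rev. Mod. Phys. 63 (1991) 239, §VI (d±id domain walls). No definition is introduced.
-/

noncomputable section

namespace Summit.HubbardSuperconductivity.HubbardSuperconductivity.Theorems

namespace BirChirality

open Matrix Finset Literature.Probability.LatticeModels
open Summit.HubbardSuperconductivity.HubbardSuperconductivity.Theorems.BirBdG
open scoped ComplexConjugate ComplexOrder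

variable {L : ℕ} [NeZero L]

/-! ### The theorem -/

/-- **The Lyapunov deficit bound for chirality textures, commutator form.** See the module
docstring. [cite: BachLiebSolovej1994, Theorem 2.11] -/
theorem chir_core (μ Δ₁ Δ₂ m : ℝ) (hL : 3 ≤ L) (ξ E : TorusSite 2 L → ℝ) (Δ A B : TorusSite 2 L → ℂ)
    (hξ : ∀ k, ξ k = -2 * Real.cos (latticeMomentum L k 0) - 2 * Real.cos (latticeMomentum L k 1) - μ)
    (hΔ : ∀ k, Δ k = ((2 * Δ₁ * (Real.cos (latticeMomentum L k 0) - Real.cos (latticeMomentum L k 1)) : ℝ) : ℂ) -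
      4 * Complex.I * ((Δ₂ * Real.sin (latticeMomentum L k 0) * Real.sin (latticeMomentum L k 1) : ℝ) : ℂ))
    (hA : ∀ k, A k = ((2 * Δ₁ * (Real.cos (latticeMomentum L k 0) - Real.cos (latticeMomentum L k 1)) : ℝ) : ℂ))
    (hB : ∀ k, B k = -(4 * Complex.I *
      ((Δ₂ * Real.sin (latticeMomentum L k 0) * Real.sin (latticeMomentum L k 1) : ℝ) : ℂ)))
    (hE : ∀ k, E k = Real.sqrt (ξ k ^ 2 + ‖Δ k‖ ^ 2)) (hm : 0 < m) (hmE : ∀ k, m ≤ E k)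
    (s : TorusSite 2 L → ℂ) (hs : ∀ x, s x = 1 ∨ s x = -1)
    (h C D : Matrix (TorusSite 2 L) (TorusSite 2 L) ℂ)
    (hh : h = Matrix.circulant (fun r : TorusSite 2 L =>
        -(if ((r = -![1, 0] ∨ r = -![-1, 0]) ∨ (r = -![0, 1] ∨ r = -![0, -1])) then (1 : ℂ) else 0) -
          (if r = 0 then (μ : ℂ) else 0)))
    (hC : C = Matrix.circulant (fun r : TorusSite 2 L =>
        (Δ₁ : ℂ) * ((if (r = -![1, 0] ∨ r = -![-1, 0]) then (1 : ℂ) else 0) -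
            (if (r = -![0, 1] ∨ r = -![0, -1]) then (1 : ℂ) else 0)) +
          Complex.I * (Δ₂ : ℂ) * ((if (r = -![1, 1] ∨ r = -![-1, -1]) then (1 : ℂ) else 0) -
            (if (r = -![1, -1] ∨ r = -![-1, 1]) then (1 : ℂ) else 0))))
    (hD : D = Matrix.circulant (fun r : TorusSite 2 L =>
        (Δ₁ : ℂ) * ((if (r = -![1, 0] ∨ r = -![-1, 0]) then (1 : ℂ) else 0) -
            (if (r = -![0, 1] ∨ r = -![0, -1]) then (1 : ℂ) else 0))) +
        (1 / 2 : ℂ) • (Matrix.diagonal s * Matrix.circulant (fun r : TorusSite 2 L =>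
            Complex.I * (Δ₂ : ℂ) * ((if (r = -![1, 1] ∨ r = -![-1, -1]) then (1 : ℂ) else 0) -
              (if (r = -![1, -1] ∨ r = -![-1, 1]) then (1 : ℂ) else 0))) +
          Matrix.circulant (fun r : TorusSite 2 L =>
            Complex.I * (Δ₂ : ℂ) * ((if (r = -![1, 1] ∨ r = -![-1, -1]) then (1 : ℂ) else 0) -
              (if (r = -![1, -1] ∨ r = -![-1, 1]) then (1 : ℂ) else 0))) * Matrix.diagonal s))
    (hX₀ : (Matrix.fromBlocks h C Cᴴ (-h)).IsHermitian) (hX : (Matrix.fromBlocks h D Dᴴ (-h)).IsHermitian) :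
    m / 4 * ∑ x : TorusSite 2 L, ∑ y : TorusSite 2 L,
        ‖(((L ^ 2 : ℕ) : ℂ)⁻¹ • ((Matrix.of fun k x : TorusSite 2 L => conj (torusChar k x))ᴴ *
            Matrix.diagonal (fun k => B k / (E k : ℂ)) *
            Matrix.of (fun k x : TorusSite 2 L => conj (torusChar k x)))) x y‖ ^ 2 * ‖s y - s x‖ ^ 2 ≤
      ∑ i, |hX₀.eigenvalues i| - ∑ i, |hX.eigenvalues i| := by
  -- the scaled plane-wave unitary `W` and `N = L²`
  have hN : (L ^ 2 : ℕ) ≠ 0 := pow_ne_zero 2 (NeZero.ne L)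
  have h1 := planeWave_conjTranspose_mul_self (d := 2) (L := L)
  have h2 := planeWave_mul_conjTranspose_self (d := 2) (L := L)
  set W : Matrix (TorusSite 2 L) (TorusSite 2 L) ℂ :=
    Matrix.of (fun k x : TorusSite 2 L => conj (torusChar k x)) with hW
  -- stencils
  set a : TorusSite 2 L → ℂ := fun r : TorusSite 2 L =>
    -(if ((r = -![1, 0] ∨ r = -![-1, 0]) ∨ (r = -![0, 1] ∨ r = -![0, -1])) then (1 : ℂ) else 0) -
      (if r = 0 then (μ : ℂ) else 0) with ha
  set dv : TorusSite 2 L → ℂ := fun r : TorusSite 2 L =>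
    (Δ₁ : ℂ) * ((if (r = -![1, 0] ∨ r = -![-1, 0]) then (1 : ℂ) else 0) -
      (if (r = -![0, 1] ∨ r = -![0, -1]) then (1 : ℂ) else 0)) +
    Complex.I * (Δ₂ : ℂ) * ((if (r = -![1, 1] ∨ r = -![-1, -1]) then (1 : ℂ) else 0) -
      (if (r = -![1, -1] ∨ r = -![-1, 1]) then (1 : ℂ) else 0)) with hdv
  set dv₁ : TorusSite 2 L → ℂ := fun r : TorusSite 2 L =>
    (Δ₁ : ℂ) * ((if (r = -![1, 0] ∨ r = -![-1, 0]) then (1 : ℂ) else 0) -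
      (if (r = -![0, 1] ∨ r = -![0, -1]) then (1 : ℂ) else 0)) with hdv₁
  set dv₂ : TorusSite 2 L → ℂ := fun r : TorusSite 2 L =>
    Complex.I * (Δ₂ : ℂ) * ((if (r = -![1, 1] ∨ r = -![-1, -1]) then (1 : ℂ) else 0) -
      (if (r = -![1, -1] ∨ r = -![-1, 1]) then (1 : ℂ) else 0)) with hdv₂
  -- positivity of the dispersion and reality of the symbols
  have hEpos : ∀ k, 0 < E k := fun k => lt_of_lt_of_le hm (hmE k)
  have hEsq : ∀ k, E k ^ 2 = ξ k ^ 2 + ‖Δ k‖ ^ 2 := fun k => by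
    rw [hE, Real.sq_sqrt (by positivity)]
  have hEsqC : ∀ k, (E k : ℂ) * (E k : ℂ) = (ξ k : ℂ) * (ξ k : ℂ) + Δ k * conj (Δ k) := fun k => by
    rw [Complex.mul_conj', ← sq, ← sq]
    exact_mod_cast hEsq k
  have hΔAB : ∀ k, Δ k = A k + B k := fun k => by
    rw [hΔ, hA, hB, sub_eq_add_neg]
  have hAconj : ∀ k, conj (A k) = A k := fun k => by
    rw [hA]
    exact Complex.conj_ofReal _
  have hBconj : ∀ k, conj (B k) = -B k := fun k => by
    rw [hB]
    simp only [map_neg, map_mul, Complex.conj_ofReal, Complex.conj_I, Complex.conj_ofNat]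
    ring
  have hcrossAB : ∀ k, (conj (A k) * B k).re = 0 := fun k => by
    apply re_eq_zero_of_conj_eq_neg
    rw [map_mul, Complex.conj_conj, hBconj, hAconj, mul_neg]
  have hAB : ∀ k, ‖Δ k‖ ^ 2 = ‖A k‖ ^ 2 + ‖B k‖ ^ 2 := fun k => by
    rw [hΔAB]
    exact normSq_add_of_re _ _ (hcrossAB k)
  have hunit : ∀ x, ‖s x‖ = 1 := fun x => by
    rcases hs x with hx | hx <;> simp [hx]
  have hsconj : ∀ x, conj (s x) = s x := fun x => by
    rcases hs x with hx | hx <;> simp [hx]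
  -- symbols
  have hFa : torusFourier a = fun k => (ξ k : ℂ) := by
    funext k
    rw [ha, torusFourier_hopVec hL μ k, hξ]
  have hFd : torusFourier dv = Δ := by
    funext k
    rw [hdv, torusFourier_pairVec hL Δ₁ Δ₂ k, hΔ]
  have hFd1 : torusFourier dv₁ = A := by
    funext k
    rw [hdv₁, torusFourier_dWaveVec hL Δ₁ k, hA]
  have hFd2 : torusFourier dv₂ = B := by
    funext k
    rw [hdv₂, torusFourier_dxyVec hL Δ₂ k, hB]
  -- plane-wave (hat) forms of the reference data
  have hath : ((L ^ 2 : ℕ) : ℂ)⁻¹ • (W * h * Wᴴ) = Matrix.diagonal (fun k => (ξ k : ℂ)) := by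
    rw [hh, hW, hat_circulant, hFa]
  have hatC : ((L ^ 2 : ℕ) : ℂ)⁻¹ • (W * C * Wᴴ) = Matrix.diagonal Δ := by
    rw [hC, hW, hat_circulant, hFd]
  have hatCh : ((L ^ 2 : ℕ) : ℂ)⁻¹ • (W * Cᴴ * Wᴴ) = (Matrix.diagonal Δ)ᴴ := by
    rw [hat_conjTranspose, hatC]
  set Ep : Matrix (TorusSite 2 L) (TorusSite 2 L) ℂ :=
    ((L ^ 2 : ℕ) : ℂ)⁻¹ • (Wᴴ * Matrix.diagonal (fun k => (E k : ℂ)) * W) with hEp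
  have hatE : ((L ^ 2 : ℕ) : ℂ)⁻¹ • (W * Ep * Wᴴ) = Matrix.diagonal (fun k => (E k : ℂ)) :=
    hat_unhat hN h2 _
  have hEpd : Ep.PosDef := posDef_unhat hN h1 (lyap_posDef_diagonal E hEpos)
  -- the hypotheses of the abstract deficit bound: identities of diagonal matrices
  have hdiagC : (Matrix.diagonal Δ)ᴴ = Matrix.diagonal (star Δ) := Matrix.diagonal_conjTranspose Δ
  have hEh : Ep * h = h * Ep := by
    apply hat_injective hN h1
    rw [← hat_mul hN h1, ← hat_mul hN h1, hatE, hath, Matrix.diagonal_mul_diagonal,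
      Matrix.diagonal_mul_diagonal]
    congr 1
    funext k
    ring
  have hEC : Ep * C = C * Ep := by
    apply hat_injective hN h1
    rw [← hat_mul hN h1, ← hat_mul hN h1, hatE, hatC, Matrix.diagonal_mul_diagonal,
      Matrix.diagonal_mul_diagonal]
    congr 1
    funext k
    ring
  have hhC : h * C = C * h := by
    apply hat_injective hN h1
    rw [← hat_mul hN h1, ← hat_mul hN h1, hath, hatC, Matrix.diagonal_mul_diagonal,
      Matrix.diagonal_mul_diagonal]
    congr 1
    funext k
    ring
  have hCC : C * Cᴴ = Cᴴ * C := by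
    apply hat_injective hN h1
    rw [← hat_mul hN h1, ← hat_mul hN h1, hatC, hatCh, hdiagC, Matrix.diagonal_mul_diagonal,
      Matrix.diagonal_mul_diagonal]
    congr 1
    funext k
    ring
  have hsq : Ep * Ep = h * h + C * Cᴴ := by
    apply hat_injective hN h1
    rw [← hat_mul hN h1, hat_add, ← hat_mul hN h1, ← hat_mul hN h1, hatE, hath, hatC, hatCh, hdiagC,
      Matrix.diagonal_mul_diagonal, Matrix.diagonal_mul_diagonal, Matrix.diagonal_mul_diagonal,
      Matrix.diagonal_add]
    congr 1
    funext k
    rw [hEsqC k]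
    rfl
  have hhH : h.IsHermitian := (Matrix.isHermitian_fromBlocks_iff.1 hX₀).1
  -- the optimal `Φ` and the abstract bound
  set Dh : Matrix (TorusSite 2 L) (TorusSite 2 L) ℂ := ((L ^ 2 : ℕ) : ℂ)⁻¹ • (W * D * Wᴴ) with hDhdef
  have hΦ := fun α => lyap_admissible hN h1 h2 E hEpos D α
  have hdef := lyap_deficit h C D Ep hhH hEpd hEh hEC hhC hCC hsq
    (∑ k, ∑ k', ‖Dh k k'‖ ^ 2 / (E k + E k')) hΦ hX₀ hX
  -- the inverse of `Ep` and the reference term `Re Tr (Ep⁻¹ Cᴴ C) = Σ_k |Δ_k|²/E_k`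
  set Ei : Matrix (TorusSite 2 L) (TorusSite 2 L) ℂ :=
    ((L ^ 2 : ℕ) : ℂ)⁻¹ • (Wᴴ * Matrix.diagonal (fun k => ((E k : ℂ))⁻¹) * W) with hEi
  have hatEi : ((L ^ 2 : ℕ) : ℂ)⁻¹ • (W * Ei * Wᴴ) = Matrix.diagonal (fun k => ((E k : ℂ))⁻¹) :=
    hat_unhat hN h2 _
  have hEinv : Ep⁻¹ = Ei := by
    apply Matrix.inv_eq_right_inv
    apply hat_injective hN h1
    rw [← hat_mul hN h1, hatE, hatEi, Matrix.diagonal_mul_diagonal, hat_one hN h2, ← Matrix.diagonal_one]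
    congr 1
    funext k
    exact mul_inv_cancel₀ (by exact_mod_cast (hEpos k).ne')
  have href : (Ep⁻¹ * (Cᴴ * C)).trace.re = ∑ k, ‖Δ k‖ ^ 2 / E k := by
    rw [hEinv, ← trace_hat hN h1, ← hat_mul hN h1, ← hat_mul hN h1, hatEi, hatCh, hatC, hdiagC,
      Matrix.diagonal_mul_diagonal, Matrix.diagonal_mul_diagonal, Matrix.trace_diagonal, Complex.re_sum]
    refine Finset.sum_congr rfl fun k _ => ?_
    rw [Pi.star_apply, Complex.star_def, show ((E k : ℂ))⁻¹ * (conj (Δ k) * Δ k) =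
      (conj (Δ k) * Δ k) / (E k : ℂ) by rw [div_eq_mul_inv, mul_comm], Complex.conj_mul',
      ← Complex.ofReal_pow, ← Complex.ofReal_div, Complex.ofReal_re]
  rw [href] at hdef
  refine le_trans ?_ hdef
  -- the pairing block mode by mode: `D^_{kk'} = δ_{kk'} A_k + ½ Ŝ_{kk'} (B_k + B_{k'})`
  set Sh : Matrix (TorusSite 2 L) (TorusSite 2 L) ℂ :=
    ((L ^ 2 : ℕ) : ℂ)⁻¹ • (W * Matrix.diagonal s * Wᴴ) with hShdef
  have hSh : ∀ k k', Sh k k' = ((L ^ 2 : ℕ) : ℂ)⁻¹ * ∑ x, s x * torusChar (k' - k) x := by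
    intro k k'
    rw [hShdef, hW, hat_diagonal_apply]
  have hDh : ∀ k k', Dh k k' = Matrix.diagonal A k k' + (1 / 2 : ℂ) * Sh k k' * (B k + B k') := by
    intro k k'
    rw [hDhdef, hD, hat_add, Matrix.add_apply, hW, hat_circulant, hFd1, hat_pairing_apply s dv₂ k k', hFd2,
      ← hSh]
  -- reality of the zero mode of `Ŝ`
  have hSdiag : ∀ k, conj (Sh k k) = Sh k k := by
    intro k
    rw [hSh, sub_self, map_mul, map_sum, map_inv₀, map_natCast]
    congr 1
    refine Finset.sum_congr rfl fun x _ => ?_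
    rw [map_mul, hsconj, torusChar_zero_left, map_one]
  -- entrywise norms: the `A`–`B` cross term vanishes
  have hhalfn : ‖(1 / 2 : ℂ)‖ = 1 / 2 := by
    rw [norm_div, norm_one, Complex.norm_two]
  have hDhn : ∀ k k', ‖Dh k k'‖ ^ 2 =
      (if k = k' then ‖A k‖ ^ 2 else 0) + (1 / 4) * (‖Sh k k'‖ ^ 2 * ‖B k + B k'‖ ^ 2) := by
    intro k k'
    rw [hDh]
    by_cases hkk : k = k'
    · subst hkk
      rw [Matrix.diagonal_apply_eq, if_pos rfl]
      have hx : (1 / 2 : ℂ) * Sh k k * (B k + B k) = Sh k k * B k := by ring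
      rw [hx, normSq_add_of_re (A k) (Sh k k * B k) ?_]
      · have h4 : ‖B k + B k‖ ^ 2 = 4 * ‖B k‖ ^ 2 := by
          rw [← two_mul, norm_mul, Complex.norm_two]
          ring
        rw [norm_mul, mul_pow, h4]
        ring
      · apply re_eq_zero_of_conj_eq_neg
        rw [map_mul, map_mul, Complex.conj_conj, hSdiag, hBconj, hAconj]
        ring
    · rw [Matrix.diagonal_apply_ne _ hkk, if_neg hkk, zero_add, zero_add, norm_mul, norm_mul, mul_pow,
        mul_pow, hhalfn]
      ring
  -- `Ŝ` is unitary: unit row and column sums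
  have hUU : Matrix.diagonal s * (Matrix.diagonal s)ᴴ = 1 := by
    rw [Matrix.diagonal_conjTranspose, Matrix.diagonal_mul_diagonal, ← Matrix.diagonal_one]
    congr 1
    funext x
    rw [Pi.star_apply, Complex.star_def, Complex.mul_conj', hunit, Complex.ofReal_one, one_pow]
  have hUU' : (Matrix.diagonal s)ᴴ * Matrix.diagonal s = 1 := by
    rw [Matrix.diagonal_conjTranspose, Matrix.diagonal_mul_diagonal, ← Matrix.diagonal_one]
    congr 1
    funext x
    rw [Pi.star_apply, Complex.star_def, Complex.conj_mul', hunit, Complex.ofReal_one, one_pow]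
  have hrow : ∀ k, ∑ k', ‖Sh k k'‖ ^ 2 = 1 := by
    refine lyap_row_normSq Sh ?_
    rw [hShdef, ← hat_conjTranspose, hat_mul hN h1, hUU, hat_one hN h2]
  have hcol : ∀ k', ∑ k, ‖Sh k k'‖ ^ 2 = 1 := by
    refine lyap_col_normSq Sh ?_
    rw [hShdef, ← hat_conjTranspose, hat_mul hN h1, hUU', hat_one hN h2]
  -- the diagonal (`A`) part of `Φ` cancels the `A` part of the reference term
  have hdiagsum : ∑ k, ∑ k', (if k = k' then ‖A k‖ ^ 2 else 0) / (E k + E k') =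
      ∑ k, ‖A k‖ ^ 2 / (2 * E k) := by
    refine Finset.sum_congr rfl fun k _ => ?_
    have hite : ∀ k', (if k = k' then ‖A k‖ ^ 2 else 0) / (E k + E k') =
        if k = k' then ‖A k‖ ^ 2 / (E k + E k') else 0 := fun k' => by
      split_ifs <;> simp
    simp_rw [hite]
    rw [Finset.sum_ite_eq, if_pos (Finset.mem_univ _), ← two_mul]
  -- the Bergström sum
  have hsplit : ∑ k, ‖Δ k‖ ^ 2 / E k - 2 * ∑ k, ∑ k', ‖Dh k k'‖ ^ 2 / (E k + E k') =
      (1 / 2) * ∑ k, ∑ k', ‖Sh k k'‖ ^ 2 *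
        (‖B k‖ ^ 2 / E k + ‖B k'‖ ^ 2 / E k' - ‖B k + B k'‖ ^ 2 / (E k + E k')) := by
    have eD : ∑ k, ∑ k', ‖Dh k k'‖ ^ 2 / (E k + E k') = ∑ k, ‖A k‖ ^ 2 / (2 * E k) +
        ∑ k, ∑ k', ‖Sh k k'‖ ^ 2 * ((1 / 4) * (‖B k + B k'‖ ^ 2 / (E k + E k'))) := by
      rw [← hdiagsum, ← Finset.sum_add_distrib]
      refine Finset.sum_congr rfl fun k _ => ?_
      rw [← Finset.sum_add_distrib]
      refine Finset.sum_congr rfl fun k' _ => ?_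
      rw [hDhn, add_div]
      ring
    have e0 : ∑ k, ‖Δ k‖ ^ 2 / E k = ∑ k, ‖A k‖ ^ 2 / E k + ∑ k, ‖B k‖ ^ 2 / E k := by
      rw [← Finset.sum_add_distrib]
      refine Finset.sum_congr rfl fun k _ => ?_
      rw [hAB, add_div]
    have eA : ∑ k, ‖A k‖ ^ 2 / E k = 2 * ∑ k, ‖A k‖ ^ 2 / (2 * E k) := by
      rw [Finset.mul_sum]
      refine Finset.sum_congr rfl fun k _ => ?_
      have hk := (hEpos k).ne'
      field_simp
    have e1 : ∑ k, ‖B k‖ ^ 2 / E k = ∑ k, ∑ k', ‖Sh k k'‖ ^ 2 * (‖B k‖ ^ 2 / E k) := by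
      refine Finset.sum_congr rfl fun k _ => ?_
      rw [← Finset.sum_mul, hrow, one_mul]
    have e2 : ∑ k, ‖B k‖ ^ 2 / E k = ∑ k, ∑ k', ‖Sh k k'‖ ^ 2 * (‖B k'‖ ^ 2 / E k') := by
      rw [Finset.sum_comm]
      refine Finset.sum_congr rfl fun k' _ => ?_
      rw [← Finset.sum_mul, hcol, one_mul]
    have e4 : ∑ k, ‖B k‖ ^ 2 / E k = (1 / 2) * ∑ k, ∑ k', ‖Sh k k'‖ ^ 2 * (‖B k‖ ^ 2 / E k) +
        (1 / 2) * ∑ k, ∑ k', ‖Sh k k'‖ ^ 2 * (‖B k'‖ ^ 2 / E k') := by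
      rw [← e1, ← e2]; ring
    rw [eD, e0, eA, show ∀ (p q r : ℝ), 2 * p + q - 2 * (p + r) = q - 2 * r from fun p q r => by ring, e4,
      Finset.mul_sum, Finset.mul_sum, Finset.mul_sum, Finset.mul_sum, ← Finset.sum_add_distrib,
      ← Finset.sum_sub_distrib]
    refine Finset.sum_congr rfl fun k _ => ?_
    rw [Finset.mul_sum, Finset.mul_sum, Finset.mul_sum, Finset.mul_sum, ← Finset.sum_add_distrib,
      ← Finset.sum_sub_distrib]
    refine Finset.sum_congr rfl fun k' _ => ?_
    ring
  have hberg : m / 4 * ∑ k, ∑ k', ‖Sh k k'‖ ^ 2 * ‖B k / (E k : ℂ) - B k' / (E k' : ℂ)‖ ^ 2 ≤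
      ∑ k, ‖Δ k‖ ^ 2 / E k - 2 * ∑ k, ∑ k', ‖Dh k k'‖ ^ 2 / (E k + E k') := by
    rw [hsplit, Finset.mul_sum, Finset.mul_sum]
    refine Finset.sum_le_sum fun k _ => ?_
    rw [Finset.mul_sum, Finset.mul_sum]
    refine Finset.sum_le_sum fun k' _ => ?_
    have hb := lyap_bergstrom hm (hmE k) (hmE k') (B k) (B k')
    have hw : 0 ≤ ‖Sh k k'‖ ^ 2 := sq_nonneg _
    calc m / 4 * (‖Sh k k'‖ ^ 2 * ‖B k / (E k : ℂ) - B k' / (E k' : ℂ)‖ ^ 2)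
        = (1 / 2) * (‖Sh k k'‖ ^ 2 * (m / 2 * ‖B k / (E k : ℂ) - B k' / (E k' : ℂ)‖ ^ 2)) := by ring
      _ ≤ (1 / 2) * (‖Sh k k'‖ ^ 2 *
          (‖B k‖ ^ 2 / E k + ‖B k'‖ ^ 2 / E k' - ‖B k + B k'‖ ^ 2 / (E k + E k'))) := by
          gcongr
  refine le_trans (le_of_eq ?_) hberg
  -- the commutator: `Σ |Ŝ_{kk'}|² |F_k - F_{k'}|² = ‖[F_B, diag s]‖²_HS` in position space
  set Fp : Matrix (TorusSite 2 L) (TorusSite 2 L) ℂ :=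
    ((L ^ 2 : ℕ) : ℂ)⁻¹ • (Wᴴ * Matrix.diagonal (fun k => B k / (E k : ℂ)) * W) with hFp
  have hatF : ((L ^ 2 : ℕ) : ℂ)⁻¹ • (W * Fp * Wᴴ) = Matrix.diagonal (fun k => B k / (E k : ℂ)) :=
    hat_unhat hN h2 _
  have hcomm : ((L ^ 2 : ℕ) : ℂ)⁻¹ • (W * (Fp * Matrix.diagonal s - Matrix.diagonal s * Fp) * Wᴴ) =
      Matrix.diagonal (fun k => B k / (E k : ℂ)) * Sh - Sh * Matrix.diagonal (fun k => B k / (E k : ℂ)) := by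
    rw [Matrix.mul_sub, Matrix.sub_mul, smul_sub, ← hat_mul hN h1, ← hat_mul hN h1, hatF]
  have hHS := lyap_sum_normSq_hat hN h1 (Fp * Matrix.diagonal s - Matrix.diagonal s * Fp)
  rw [hcomm] at hHS
  have lhs_entry : ∀ k k', ‖(Matrix.diagonal (fun k => B k / (E k : ℂ)) * Sh -
      Sh * Matrix.diagonal (fun k => B k / (E k : ℂ))) k k'‖ ^ 2 =
      ‖Sh k k'‖ ^ 2 * ‖B k / (E k : ℂ) - B k' / (E k' : ℂ)‖ ^ 2 := by
    intro k k'
    rw [Matrix.sub_apply, Matrix.diagonal_mul, Matrix.mul_diagonal,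
      show B k / (E k : ℂ) * Sh k k' - Sh k k' * (B k' / (E k' : ℂ)) =
        Sh k k' * (B k / (E k : ℂ) - B k' / (E k' : ℂ)) by ring, norm_mul, mul_pow]
  have rhs_entry : ∀ x y, ‖(Fp * Matrix.diagonal s - Matrix.diagonal s * Fp) x y‖ ^ 2 =
      ‖Fp x y‖ ^ 2 * ‖s y - s x‖ ^ 2 := by
    intro x y
    rw [Matrix.sub_apply, Matrix.mul_diagonal, Matrix.diagonal_mul,
      show Fp x y * s y - s x * Fp x y = Fp x y * (s y - s x) by ring, norm_mul, mul_pow]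
  simp_rw [lhs_entry, rhs_entry] at hHS
  rw [hHS]

end BirChirality

/-! ### Registered sub-goal of the crux item (line `chirality-sheet-peierls`, stub W) -/

/-- **The chirality-wall commutator bound** `(m/4) ‖[F_B, diag s]‖²_HS ≤ S(+) - S(σ)` — registered
sub-goal `chiralityWallCommutatorBound` of item stmt-HubbardSuperconductivity-14846 (wrapper of
`BirChirality.chir_core`, all objects explicit). [cite: BachLiebSolovej1994, Theorem 2.11] -/
theorem chiralityWallCommutatorBound : ∀ (L : ℕ) [NeZero L] (μ Δ₁ Δ₂ m : ℝ), 3 ≤ L → ∀ (ξ E : Literature.Probability.LatticeModels.TorusSite 2 L → ℝ) (Δ A B : Literature.Probability.LatticeModels.TorusSite 2 L → ℂ), (∀ k, ξ k = -2 * Real.cos (Literature.Probability.LatticeModels.latticeMomentum L k 0) - 2 * Real.cos (Literature.Probability.LatticeModels.latticeMomentum L k 1) - μ) → (∀ k, Δ k = ((2 * Δ₁ * (Real.cos (Literature.Probability.LatticeModels.latticeMomentum L k 0) - Real.cos (Literature.Probability.LatticeModels.latticeMomentum L k 1)) : ℝ) : ℂ) - 4 * Complex.I * ((Δ₂ * Real.sin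 (Literature.Probability.LatticeModels.latticeMomentum L k 0) * Real.sin (Literature.Probability.LatticeModels.latticeMomentum L k 1) : ℝ) : ℂ)) → (∀ k, A k = ((2 * Δ₁ * (Real.cos (Literature.Probability.LatticeModels.latticeMomentum L k 0) - Real.cos (Literature.Probability.LatticeModels.latticeMomentum L k 1)) : ℝ) : ℂ)) → (∀ k, B k = -(4 * Complex.I * ((Δ₂ * Real.sin (Literature.Probability.LatticeModels.latticeMomentum L k 0) * Real.sin (Literature.Probability.LatticeModels.latticeMomentum L k 1) : ℝ) : ℂ))) → (∀ k, E k = Real.sqrt (ξ k ^ 2 + ‖Δ k‖ ^ 2)) → 0 < m → (∀ k, m ≤ E k) → ∀ (s : Literature.Probability.LatticeModels.TorusSite 2 L → ℂ), (∀ x, s x = 1 ∨ s x = -1) → ∀ (h C D : Matrix (Literature.Probability.LatticeModels.TorusSite 2 L) (Literature.Probability.LatticeModels.TorusSite 2 L) ℂ), h = Matrix.circulant (fun r : Literature.Probability.LatticeModels.TorusSite 2 L => -(if ((r = -![1, 0] ∨ r = -![-1, 0]) ∨ (r = -![0, 1] ∨ r = -![0, -1])) then (1 : ℂ) else 0) -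 (if r = 0 then (μ : ℂ) else 0)) → C = Matrix.circulant (fun r : Literature.Probability.LatticeModels.TorusSite 2 L => (Δ₁ : ℂ) * ((if (r = -![1, 0] ∨ r = -![-1, 0]) then (1 : ℂ) else 0) - (if (r = -![0, 1] ∨ r = -![0, -1]) then (1 : ℂ) else 0)) + Complex.I * (Δ₂ : ℂ) * ((if (r = -![1, 1] ∨ r = -![-1, -1]) then (1 : ℂ) else 0) - (if (r = -![1, -1] ∨ r = -![-1, 1]) then (1 : ℂ) else 0))) → D = Matrix.circulant (fun r : Literature.Probability.LatticeModels.TorusSite 2 L => (Δ₁ : ℂ) * ((if (r = -![1, 0] ∨ r = -![-1, 0]) then (1 : ℂ) else 0) - (if (r = -![0, 1] ∨ r = -![0, -1]) then (1 : ℂ) else 0))) + (1 / 2 : ℂ) • (Matrix.diagonal s * Matrix.circulant (fun r : Literature.Probability.LatticeModels.TorusSite 2 L => Complex.I * (Δ₂ : ℂ) * ((if (r = -![1, 1] ∨ r = -![-1, -1]) then (1 : ℂ) else 0) - (if (r = -![1, -1] ∨ r = -![-1, 1]) then (1 : ℂ) else 0))) + Matrix.circulant (fun r : Literature.Probability.LatticeModels.TorusSite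 2 L => Complex.I * (Δ₂ : ℂ) * ((if (r = -![1, 1] ∨ r = -![-1, -1]) then (1 : ℂ) else 0) - (if (r = -![1, -1] ∨ r = -![-1, 1]) then (1 : ℂ) else 0))) * Matrix.diagonal s) → ∀ (hX₀ : (Matrix.fromBlocks h C (Matrix.conjTranspose C) (-h)).IsHermitian) (hX : (Matrix.fromBlocks h D (Matrix.conjTranspose D) (-h)).IsHermitian), m / 4 * ∑ x : Literature.Probability.LatticeModels.TorusSite 2 L, ∑ y : Literature.Probability.LatticeModels.TorusSite 2 L, ‖(((L ^ 2 : ℕ) : ℂ)⁻¹ • (Matrix.conjTranspose (Matrix.of (fun k x : Literature.Probability.LatticeModels.TorusSite 2 L => (starRingEnd ℂ) (Literature.Probability.LatticeModels.torusChar k x))) * Matrix.diagonal (fun k => B k / (E k : ℂ)) * Matrix.of (fun k x : Literature.Probability.LatticeModels.TorusSite 2 L => (starRingEnd ℂ) (Literature.Probability.LatticeModels.torusChar k x)))) x y‖ ^ 2 * ‖s y - s x‖ ^ 2 ≤ ∑ i, |hX₀.eigenvalues i| - ∑ i, |hX.eigenvalues i| :=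
  fun _ _ μ Δ₁ Δ₂ m hL ξ E Δ A B hξ hΔ hA hB hE hm hmE s hs h C D hh hC hD hX₀ hX =>
    BirChirality.chir_core μ Δ₁ Δ₂ m hL ξ E Δ A B hξ hΔ hA hB hE hm hmE s hs h C D hh hC hD hX₀ hX

end Summit.HubbardSuperconductivity.HubbardSuperconductivity.Theorems

end
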